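import Literature.Combinatorics.Optimization.MISHardnessParameter
import HarnessLib

/-!
# The Rydberg-blockade encoding of MIS: King's-lattice unit-disk graphs and the MIS cost function

Topic `Literature/Combinatorics/Optimization` (pub-qadeq lane, CLAIMS §5 rows E-34 — Ebadi et al.,
MIS on ‘unit-disk (King's-lattice-type, Rydberg-blockade radius) graphs’ — and E-62, ‘Maximum
Independent Set as a penalised Ising problem’; counter Andrist et al. 2023). Companion of
`MISHardnessParameter.lean` (same directory; `indepNum`, `IsMaximumIndepSet`, `D_{|MIS|}`).

HONEST FRAMING: instance-level adjudication of specific advantage claims; no claim about BQP vs BPP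
or the summit. The file types the INSTANCE FAMILY and the COST FUNCTION of these rows and proves two
elementary printed facts about them; nothing about any device, pulse, annealer or runtime.

## Source statements formalised

* “We consider unit-disk graphs with nodes arranged on a two-dimensional square lattice with lattice
  spacing a and filling fraction ϱ ∼ 80%, and edges connecting all pairs of nodes within a unit
  distance (illustrated by the circle). For √2a ≤ R_b < 2a (as considered here), nodes are connected
  to nearest and next-nearest neighbors resulting in a (quasi-planar) Union-Jack pattern with
  maximum
  degree d_max = 8.” [cite: AndristEtAl2023, §I Fig. 1 caption]; “the ensemble of graphs encoded on
  our Rydberg programmable quantum simulator, consisting of vertices placed on a square lattice and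
  with edges between nearest and next-nearest (diagonal) neighbours” [cite: EbadiEtAl2022,
  Supplementary Materials §1]; “due the geometric layout of the ensemble of unit disk graphs studied
  in this work, the maximum degree of any vertex is eight” [cite: EbadiEtAl2022, Supplementary
  Materials §8.1].
* “the second Hamiltonian is the “standard” MIS Hamiltonian H_cost^MIS = −Σ_{i∈V} n_i +
  Σ_{(i,j)∈E} α n_i n_j, where α is a uniform penalty on each edge. To guarantee that the ground
  state
  of Eq. (S15) corresponds to the MIS, we must have α > 1, so that it is strictly more energetically
  favorable to have at most one vertex per edge in state |1⟩, as opposed to both vertices in state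
  |1⟩. Under these conditions, the ground state maximizes the number of spins in the corresponding
  set subject to the independent set constraint.” [cite: EbadiEtAl2022, Supplementary Materials §8
  eq. (S15)]

## Contents (all proved; 0 named facts)

* Part A — the instance family. `kingsGraph : SimpleGraph (ℤ × ℤ)` (nearest + next-nearest
  neighbours = Chebyshev distance 1), `gridUnitDisk R` (squared Euclidean distance `≤ R²` between
  distinct lattice sites, lattice units), **`gridUnitDisk_eq_kingsGraph`** (for `√2 ≤ R < 2` the two
  coincide — the printed ‘√2a ≤ R_b < 2a’ sentence, via `sqDist_le_two_iff`: an integer vector has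
  squared length ≤ 2 iff both coordinates have absolute value ≤ 1, and squared length 3 does not
  occur); `kingsGraphOn pos` (a finite instance = atoms at injective lattice positions) with
  **`degree_kingsGraphOn_le`** (`d_max ≤ 8`) and `card_edgeFinset_kingsGraphOn_le` (`|E| ≤ 4N`,
  handshake).
* Part B — the cost function. `violations G x` (number of edges inside `x`), `misCost G α x =
  −|x| + α·violations` (= `H_cost^MIS` on the bit string `x`), `violations_eq_zero_iff`
  (independent sets), `exists_indepSet_card_ge` (deleting one endpoint per violated edge: an
  independent `y ⊆ x` with `|y| + violations x ≥ |x|`), **`neg_indepNum_le_misCost`** (`α ≥ 1`: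
  `H ≥ −|MIS|`), `misCost_of_isMaximumIndepSet` (`= −|MIS|` on every MIS) and
  **`misCost_eq_neg_indepNum_iff`** (`α > 1`: the ground states are EXACTLY the maximum independent
  sets — the printed ‘we must have α > 1’, with its reason on the smallest instance: at `α = 1` both
  endpoints of a single edge cost the same as one, `misCost_pair_eq_of_alpha_one`).
* NOT here: NP-completeness of MIS on this ensemble (SM §1's reduction), the Rydberg `1/r⁶` cost
  `H_cost^Ryd`, filling fractions / random instance generation, the exact edge count
  `|E|_max = 4L² − 6L + 2` of the full `L × L` pattern (checked below by `decide` at `L = 2, 3`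
  only).

## References

* [EbadiEtAl2022] S. Ebadi et al., Science 376, 1209 (2022) = arXiv:2202.09372: main text
  (‘80% of an underlying square lattice, with the blockade extending across nearest and next-nearest
  (diagonal) neighbors’), Supplementary Materials §1 (ensemble), §8 eq. (S15) (H_cost^MIS, α > 1),
  §8.1 (‘maximum degree of any vertex is eight’). Held text chunks p0003 L2, p0007 L3, p0016 L20–26
  and L53.
* [AndristEtAl2023] R. S. Andrist et al., Phys. Rev. Research 5, 043277 (2023) = arXiv:2307.09442:
  Fig. 1 caption (√2a ≤ R_b < 2a ⇒ Union-Jack, d_max = 8), §II.C (|E|_max = 4L² − 6L + 2). Fetched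
  text p0002 L2–L13, p0003 L28–L41.
-/

namespace Literature.Combinatorics.Optimization

namespace RydbergMIS

open Finset SimpleGraph

/-! ## Part A — King's-lattice unit-disk graphs -/

/-- Squared Euclidean distance between lattice sites (lattice units). [cite: AndristEtAl2023, §I
Fig. 1 caption (“edges connecting all pairs of nodes within a unit distance”)] -/
def sqDist (p q : ℤ × ℤ) : ℤ := (p.1 - q.1) ^ 2 + (p.2 - q.2) ^ 2

/-- `sqDist` is symmetric. [folklore] -/
private theorem sqDist_comm (p q : ℤ × ℤ) : sqDist p q = sqDist q p := by
  unfold sqDist; ring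

/-- The unit-disk (blockade) graph on the square lattice at blockade radius `R` (lattice units):
distinct sites at Euclidean distance `≤ R`. [cite: AndristEtAl2023, §I Fig. 1 caption]
[cite: EbadiEtAl2022, main text (“the blockade radius R_b … determines the connectivity of the
graph”)] -/
def gridUnitDisk (R : ℝ) : SimpleGraph (ℤ × ℤ) where
  Adj p q := p ≠ q ∧ (sqDist p q : ℝ) ≤ R ^ 2
  symm := ⟨fun p q h => ⟨h.1.symm, by rw [sqDist_comm]; exact h.2⟩⟩
  loopless := ⟨fun p h => h.1 rfl⟩

/-- The King's graph (‘Union-Jack pattern’): nearest and next-nearest (diagonal) neighbours on the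
square lattice, i.e. distinct sites at Chebyshev distance `1`. [cite: EbadiEtAl2022, Supplementary
Materials §1 (“edges between nearest and next-nearest (diagonal) neighbours”)]
[cite: AndristEtAl2023, §I Fig. 1 caption] -/
def kingsGraph : SimpleGraph (ℤ × ℤ) where
  Adj p q := p ≠ q ∧ |p.1 - q.1| ≤ 1 ∧ |p.2 - q.2| ≤ 1
  symm := ⟨fun p q h =>
    ⟨h.1.symm, by rw [abs_sub_comm]; exact h.2.1, by rw [abs_sub_comm]; exact h.2.2⟩⟩
  loopless := ⟨fun p h => h.1 rfl⟩

/-- Adjacency in the King's graph is decidable (integer comparisons). [folklore] -/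
instance : DecidableRel kingsGraph.Adj := fun p q =>
  inferInstanceAs (Decidable (p ≠ q ∧ |p.1 - q.1| ≤ 1 ∧ |p.2 - q.2| ≤ 1))

/-- An integer has `|a| ≤ 1` iff `a² ≤ 1`, and then `a² ≤ 2` as well; conversely `a² ≤ 2 → |a| ≤ 1`.
[folklore] -/
private theorem abs_le_one_iff_sq_le_two (a : ℤ) : |a| ≤ 1 ↔ a ^ 2 ≤ 2 := by
  constructor
  · intro h
    have h1 : |a| ^ 2 ≤ 1 := by nlinarith [abs_nonneg a]
    rw [sq_abs] at h1
    omega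
  · intro h
    by_contra h'
    push Not at h'
    have h2 : (2 : ℤ) ≤ |a| := by omega
    have h3 : 4 ≤ |a| ^ 2 := by nlinarith
    rw [sq_abs] at h3
    omega

/-- **Integer vectors of squared length ≤ 2 are exactly the King moves**: for `d ∈ ℤ²`,
`d₁² + d₂² ≤ 2 ↔ |d₁| ≤ 1 ∧ |d₂| ≤ 1`. [folklore] -/
private theorem sqDist_le_two_iff (p q : ℤ × ℤ) :
    sqDist p q ≤ 2 ↔ |p.1 - q.1| ≤ 1 ∧ |p.2 - q.2| ≤ 1 := by
  rw [abs_le_one_iff_sq_le_two, abs_le_one_iff_sq_le_two, sqDist]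
  constructor
  · intro h
    constructor <;> nlinarith [sq_nonneg (p.1 - q.1), sq_nonneg (p.2 - q.2)]
  · rintro ⟨h1, h2⟩
    -- squares are `0, 1, 4, …`: `a² ≤ 2` forces `a² ≤ 1`
    have h1' : (p.1 - q.1) ^ 2 ≤ 1 := by
      rcases (abs_le_one_iff_sq_le_two _).2 h1 |> abs_le.1 with ⟨ha, hb⟩
      nlinarith
    have h2' : (p.2 - q.2) ^ 2 ≤ 1 := by
      rcases (abs_le_one_iff_sq_le_two _).2 h2 |> abs_le.1 with ⟨ha, hb⟩
      nlinarith
    omega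

/-- A squared length `3` does not occur in `ℤ²`: `sqDist ≤ 3 → sqDist ≤ 2`. [folklore] -/
private theorem sqDist_le_two_of_le_three {p q : ℤ × ℤ} (h : sqDist p q ≤ 3) : sqDist p q ≤ 2 := by
  -- if `d₁² + d₂² = 3` then one square is ≥ 2, hence ≥ 4: contradiction
  by_contra h'
  have h3 : sqDist p q = 3 := by omega
  unfold sqDist at h3
  have ha : (p.1 - q.1) ^ 2 ≤ 3 := by nlinarith [sq_nonneg (p.2 - q.2)]
  have hb : (p.2 - q.2) ^ 2 ≤ 3 := by nlinarith [sq_nonneg (p.1 - q.1)]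
  -- an integer square ≤ 3 is ≤ 1
  have key : ∀ a : ℤ, a ^ 2 ≤ 3 → a ^ 2 ≤ 1 := by
    intro a ha3
    have : |a| ≤ 1 := by
      by_contra hc
      push Not at hc
      have : (2 : ℤ) ≤ |a| := by omega
      have : 4 ≤ |a| ^ 2 := by nlinarith
      rw [sq_abs] at this
      omega
    have := abs_le.1 this
    nlinarith [this.1, this.2]
  have := key _ ha
  have := key _ hb
  omega

/-- **For `√2·a ≤ R_b < 2a` the blockade graph IS the King's graph** (“nodes are connected to
nearest
and next-nearest neighbors resulting in a (quasi-planar) Union-Jack pattern”).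
[cite: AndristEtAl2023, §I Fig. 1 caption] [cite: EbadiEtAl2022, main text (“the blockade extending
across nearest and next-nearest (diagonal) neighbors”)] -/
theorem gridUnitDisk_eq_kingsGraph {R : ℝ} (h1 : Real.sqrt 2 ≤ R) (h2 : R < 2) :
    gridUnitDisk R = kingsGraph := by
  have hR0 : 0 ≤ R := le_trans (Real.sqrt_nonneg 2) h1
  have hR2 : (2 : ℝ) ≤ R ^ 2 := by
    have := Real.sq_sqrt (show (0 : ℝ) ≤ 2 by norm_num)
    nlinarith [Real.sqrt_nonneg 2]
  have hR4 : R ^ 2 < 4 := by nlinarith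
  ext p q
  change (p ≠ q ∧ (sqDist p q : ℝ) ≤ R ^ 2) ↔ (p ≠ q ∧ |p.1 - q.1| ≤ 1 ∧ |p.2 - q.2| ≤ 1)
  rw [← sqDist_le_two_iff]
  refine and_congr Iff.rfl ⟨fun h => ?_, fun h => ?_⟩
  · have h3 : (sqDist p q : ℝ) < 4 := lt_of_le_of_lt h hR4
    have h3' : sqDist p q ≤ 3 := by
      have : (sqDist p q : ℝ) < (4 : ℤ) := by exact_mod_cast h3
      exact Int.lt_add_one_iff.1 (by exact_mod_cast this)
    exact sqDist_le_two_of_le_three h3'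
  · calc (sqDist p q : ℝ) ≤ 2 := by exact_mod_cast h
      _ ≤ R ^ 2 := hR2

/-! ### Finite instances: atoms at lattice sites -/

variable {V : Type*} [Fintype V] [DecidableEq V]

/-- A finite instance: vertices `V` placed at distinct lattice sites `pos : V ↪ ℤ × ℤ`, with the
King's-graph adjacency (“atoms are deterministically positioned by optical tweezers at target
locations corresponding to the graph vertices”). [cite: EbadiEtAl2022, main text ‘Quantum
Optimization on Different Graphs’ / Methods] [cite: AndristEtAl2023, §II.C] -/
def kingsGraphOn (pos : V ↪ ℤ × ℤ) : SimpleGraph V := kingsGraph.comap pos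

/-- Adjacency of a finite instance is decidable. [folklore] -/
instance (pos : V ↪ ℤ × ℤ) : DecidableRel (kingsGraphOn pos).Adj :=
  inferInstanceAs (DecidableRel (kingsGraph.comap pos).Adj)

/-- The eight King moves. [folklore] -/
private def moves : Finset (ℤ × ℤ) :=
  (({-1, 0, 1} : Finset ℤ) ×ˢ ({-1, 0, 1} : Finset ℤ)).erase (0, 0)

/-- There are eight King moves. [folklore] -/
private theorem card_moves : moves.card = 8 := by decide

/-- A King's-graph neighbour differs by a King move. [folklore] -/
private theorem mem_moves_of_adj {p q : ℤ × ℤ} (h : kingsGraph.Adj p q) : q - p ∈ moves := by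
  obtain ⟨hne, h1, h2⟩ := h
  rw [moves, mem_erase, mem_product]
  refine ⟨fun h0 => hne ?_, ?_, ?_⟩
  · have := Prod.ext_iff.1 h0
    simp only [Prod.fst_sub, Prod.snd_sub, sub_eq_zero] at this
    exact Prod.ext this.1.symm this.2.symm
  · have := abs_le.1 h1
    simp only [Prod.fst_sub, mem_insert, mem_singleton]
    omega
  · have := abs_le.1 h2
    simp only [Prod.snd_sub, mem_insert, mem_singleton]
    omega

omit [DecidableEq V] in
/-- **Maximum degree 8** (“maximum degree d_max = 8”; “the maximum degree of any vertex is eight”).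
[cite: AndristEtAl2023, §I Fig. 1 caption] [cite: EbadiEtAl2022, Supplementary Materials §8.1] -/
theorem degree_kingsGraphOn_le (pos : V ↪ ℤ × ℤ) (v : V) : (kingsGraphOn pos).degree v ≤ 8 := by
  rw [← card_neighborFinset_eq_degree, ← card_moves]
  refine card_le_card_of_injOn (fun w => pos w - pos v) (fun w hw => ?_) ?_
  · rw [mem_coe, mem_neighborFinset] at hw
    exact mem_moves_of_adj hw
  · intro w _ w' _ h
    exact pos.injective (sub_left_injective h)

omit [DecidableEq V] in
/-- Hence `|E| ≤ 4N` for an `N`-atom instance (handshake). [cite: AndristEtAl2023, §II.C (edge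
counts of Union-Jack instances)] -/
theorem card_edgeFinset_kingsGraphOn_le (pos : V ↪ ℤ × ℤ) :
    (kingsGraphOn pos).edgeFinset.card ≤ 4 * Fintype.card V := by
  have h := (kingsGraphOn pos).sum_degrees_eq_twice_card_edges
  have h8 : ∑ v, (kingsGraphOn pos).degree v ≤ ∑ _v : V, 8 :=
    sum_le_sum fun v _ => degree_kingsGraphOn_le pos v
  rw [sum_const, card_univ, smul_eq_mul] at h8
  omega

/-- The full `L × L` pattern (`ϱ = 100%`), as an instance. [cite: AndristEtAl2023, §II.C] -/
def fullGrid (L : ℕ) : Fin L × Fin L ↪ ℤ × ℤ :=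
  ⟨fun p => ((p.1 : ℕ), (p.2 : ℕ)), fun p q h => by
    simp only [Prod.mk.injEq, Nat.cast_inj] at h
    exact Prod.ext (Fin.ext h.1) (Fin.ext h.2)⟩

/-- `|E|_max = 4L² − 6L + 2` checked at `L = 2` (`= 6`, the complete graph `K₄`).
[cite: AndristEtAl2023, §II.C (“|E|_max = 4L² − 6L + 2”)] -/
example : (kingsGraphOn (fullGrid 2)).edgeFinset.card = 4 * 2 ^ 2 - 6 * 2 + 2 := by decide

/-- … and at `L = 3` (`= 20`). [cite: AndristEtAl2023, §II.C (“|E|_max = 4L² − 6L + 2”)] -/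
example : (kingsGraphOn (fullGrid 3)).edgeFinset.card = 4 * 3 ^ 2 - 6 * 3 + 2 := by decide

/-! ## Part B — the MIS cost function `H = −Σ n_i + α Σ_{(i,j)∈E} n_i n_j` -/

section cost

variable (G : SimpleGraph V) [DecidableRel G.Adj]

/-- The number of violated edges of a vertex set `x` (edges of `G` with both endpoints in `x`):
the value of `Σ_{(i,j)∈E} n_i n_j` on the bit string `x`. [cite: EbadiEtAl2022, Supplementary
Materials §8 eq. (S15)] -/
def violations (x : Finset V) : ℕ := (G.edgeFinset.filter fun e => ∀ v ∈ e, v ∈ x).card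

/-- `H_cost^MIS(x) = −Σ_i n_i + α Σ_{(i,j)∈E} n_i n_j = −|x| + α · violations x`.
[cite: EbadiEtAl2022, Supplementary Materials §8 eq. (S15)] -/
def misCost (α : ℝ) (x : Finset V) : ℝ := -(x.card : ℝ) + α * violations G x

variable {G}

/-- No violated edge iff `x` is an independent set. [cite: EbadiEtAl2022, Supplementary Materials
§8 (“the independent set constraint”)] -/
theorem violations_eq_zero_iff (x : Finset V) : violations G x = 0 ↔ G.IsIndepSet (x : Set V) := by
  rw [violations, card_eq_zero, filter_eq_empty_iff, isIndepSet_iff]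
  constructor
  · intro h u hu v hv _ hadj
    exact h (x := s(u, v)) (by rwa [mem_edgeFinset, mem_edgeSet])
      (fun w hw => by rcases Sym2.mem_iff.1 hw with rfl | rfl <;> assumption)
  · intro h e he hall
    induction e using Sym2.ind with
    | _ u v =>
      rw [mem_edgeFinset, mem_edgeSet] at he
      exact h (hall u (by simp)) (hall v (by simp)) he.ne he

/-- Removing an endpoint of a violated edge removes at least that violation.
[cite: EbadiEtAl2022, Supplementary Materials §8 (“at most one vertex per edge”)] -/
theorem violations_erase_lt {x : Finset V} {u v : V} (hu : u ∈ x) (hv : v ∈ x) (h : G.Adj u v) :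
    violations G (x.erase u) < violations G x := by
  unfold violations
  refine card_lt_card ⟨fun e he => ?_, fun hsub => ?_⟩
  · rw [mem_filter] at he ⊢
    exact ⟨he.1, fun w hw => mem_of_mem_erase (he.2 w hw)⟩
  · have hmem : s(u, v) ∈ G.edgeFinset.filter fun e => ∀ w ∈ e, w ∈ x := by
      rw [mem_filter, mem_edgeFinset, mem_edgeSet]
      exact ⟨h, fun w hw => by rcases Sym2.mem_iff.1 hw with rfl | rfl <;> assumption⟩
    have := (mem_filter.1 (hsub hmem)).2 u (by simp)
    exact (notMem_erase u x) this

/-- **One endpoint per violated edge**: every vertex set `x` contains an independent set `y` with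
`|y| + violations(x) ≥ |x|`. [cite: EbadiEtAl2022, Supplementary Materials §8 (“it is strictly more
energetically favorable to have at most one vertex per edge”)] -/
theorem exists_indepSet_card_ge (x : Finset V) :
    ∃ y ⊆ x, G.IsIndepSet (y : Set V) ∧ x.card ≤ y.card + violations G x := by
  induction x using Finset.strongInduction with
  | H x ih =>
    by_cases hind : G.IsIndepSet (x : Set V)
    · exact ⟨x, Subset.rfl, hind, by omega⟩
    · rw [isIndepSet_iff] at hind
      simp only [Set.Pairwise, mem_coe, not_forall, not_not, exists_prop] at hind
      obtain ⟨u, hu, v, hv, _, hadj⟩ := hind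
      obtain ⟨y, hy, hyind, hcard⟩ := ih (x.erase u) (erase_ssubset hu)
      refine ⟨y, hy.trans (erase_subset u x), hyind, ?_⟩
      have h1 := violations_erase_lt hu hv hadj
      have h2 := card_erase_add_one hu
      omega

/-- **`H ≥ −|MIS|` for `α ≥ 1`.** [cite: EbadiEtAl2022, Supplementary Materials §8 eq. (S15)] -/
theorem neg_indepNum_le_misCost {α : ℝ} (hα : 1 ≤ α) (x : Finset V) :
    -(G.indepNum : ℝ) ≤ misCost G α x := by
  obtain ⟨y, -, hyind, hcard⟩ := exists_indepSet_card_ge (G := G) x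
  have hy := hyind.card_le_indepNum
  unfold misCost
  have hv : (0 : ℝ) ≤ violations G x := Nat.cast_nonneg _
  have hc : (x.card : ℝ) ≤ y.card + violations G x := by exact_mod_cast hcard
  have hy' : (y.card : ℝ) ≤ G.indepNum := by exact_mod_cast hy
  nlinarith

/-- Every maximum independent set attains `−|MIS|`. [cite: EbadiEtAl2022, Supplementary Materials
§8 (“the ground state maximizes the number of spins … subject to the independent set constraint”)]
-/
theorem misCost_of_isMaximumIndepSet (α : ℝ) {x : Finset V} (hx : G.IsMaximumIndepSet x) :
    misCost G α x = -(G.indepNum : ℝ) := by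
  rw [misCost, (violations_eq_zero_iff x).2 hx.isIndepSet, maximumIndepSet_card_eq_indepNum x hx]
  simp

/-- **For `α > 1` the ground states of `H_cost^MIS` are EXACTLY the maximum independent sets** (and
the ground energy is `−|MIS|`). [cite: EbadiEtAl2022, Supplementary Materials §8 eq. (S15) (“To
guarantee that the ground state of Eq. (S15) corresponds to the MIS, we must have α > 1 … Under
these
conditions, the ground state maximizes the number of spins in the corresponding set subject to the
independent set constraint”)] -/
theorem misCost_eq_neg_indepNum_iff {α : ℝ} (hα : 1 < α) (x : Finset V) :
    misCost G α x = -(G.indepNum : ℝ) ↔ G.IsMaximumIndepSet x := by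
  refine ⟨fun h => ?_, misCost_of_isMaximumIndepSet α⟩
  obtain ⟨y, hyx, hyind, hcard⟩ := exists_indepSet_card_ge (G := G) x
  have hy := hyind.card_le_indepNum
  have hc : (x.card : ℝ) ≤ y.card + violations G x := by exact_mod_cast hcard
  have hy' : (y.card : ℝ) ≤ G.indepNum := by exact_mod_cast hy
  unfold misCost at h
  -- the violation count must vanish, else `α·e > e` makes the energy exceed `−|MIS|`
  have hv0 : violations G x = 0 := by
    by_contra hne
    have hpos : (1 : ℝ) ≤ violations G x := by exact_mod_cast Nat.one_le_iff_ne_zero.2 hne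
    nlinarith
  have hind : G.IsIndepSet (x : Set V) := (violations_eq_zero_iff x).1 hv0
  rw [hv0, Nat.cast_zero, mul_zero, add_zero, neg_inj, Nat.cast_inj] at h
  exact (MISHardness.mem_indepSetFinset_indepNum_iff G x).1
    (mem_indepSetFinset_iff.2 ⟨hind, h⟩)

/-- Why `α > 1` and not `α ≥ 1` — the printed reason (“as opposed to both vertices in state |1⟩”)
on the smallest instance: on a single edge (`K₂`), at `α = 1` the NON-independent set `{0, 1}` has
the
same energy `−1` as the MIS `{0}`. [cite: EbadiEtAl2022, Supplementary Materials §8 eq. (S15)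
(“we must have α > 1, so that it is strictly more energetically favorable to have at most one vertex
per edge in state |1⟩, as opposed to both vertices in state |1⟩”)] -/
theorem misCost_pair_eq_of_alpha_one :
    misCost (⊤ : SimpleGraph (Fin 2)) 1 {0, 1} = misCost (⊤ : SimpleGraph (Fin 2)) 1 {0} := by
  have h1 : violations (⊤ : SimpleGraph (Fin 2)) {0, 1} = 1 := by decide
  have h2 : violations (⊤ : SimpleGraph (Fin 2)) {0} = 0 := by decide
  rw [misCost, misCost, h1, h2, card_pair (by decide), card_singleton]
  norm_num

end cost

end RydbergMIS

end Literature.Combinatorics.Optimization
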